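import Mathlib
import Summits.Ventures.PercRepro2.K5HyperK3CmpB

/-!
# THE `M-TRI` CERTIFICATES OF THE CRUX KERNEL AT THE COINCIDENCE `b = a₃` (marking `b = 3`), PART 2b
(blind cell PercRepro2, typer-1 g12 — the RE-EMISSION of `K5HyperCertK3B3M2.lean`'s fifth certificate as its own module,
RULING (F′) (lead g41, 2026-08-26T02:00:45Z) on ref-2 g7's KERNEL NOTE 01:58:11Z: the five-in-one-process elaboration of
that file trips a recursion / resource limit on a referee node while every theorem elaborates in pieces; the remedy of
record is the owner's re-emission in smaller kernel steps — theorems 1–4 stay in `K5HyperCertK3B3M2.lean`, theorem 5 is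
proved here under its own name and `K5HyperCertK3B3M2.lean`'s `cert_M3b3_023_02` becomes its alias)

`CertLE (kNegM3b 3 (triMask T) (pairMask e)) (kPosM3b 3 …)`: `N(K₅ + T(1) + e(1)) ≥ N(K₅ + T(1))` for the (TRI) kernel `K₃`
at the marking `(0, 1, 2, 3, 3)`, every `K₅` profile (`240` products of three Kronecker numbers; base `2^23`).  One
`decide +kernel` under `maxHeartbeats 0` (the rule of record of g10); twin `k5hyper_k3cmp_b_typer.py 3`.
-/

namespace Summit.Ventures.PercRepro2

namespace K5

set_option maxRecDepth 100000 in
set_option maxHeartbeats 0 in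
/-- `M-TRI ≥ 0` at the marking `b = 3` on the triangle `T = {0, 2, 3}`, pair `e = {0, 2}` (the fifth certificate of
`K5HyperCertK3B3M2.lean`, re-emitted as its own kernel step). -/
theorem cert_M3b3_023_02_split :
    CertLE (kNegM3b 3 (triMask 0 2 3) (pairMask 0 2))
      (kPosM3b 3 (triMask 0 2 3) (pairMask 0 2)) := by
  unfold CertLE
  decide +kernel

end K5

end Summit.Ventures.PercRepro2
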